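import Literature.Computability.AlgebraicComplexity.BurgisserPerturbedCharpolyHeight
import Mathlib.RingTheory.Polynomial.Resultant.Basic
import Mathlib.RingTheory.IntegralClosure.IntegrallyClosed
import Mathlib.RingTheory.Polynomial.GaussLemma
import Mathlib.FieldTheory.Separable
import Mathlib.FieldTheory.Minpoly.Field
import Mathlib.Algebra.Polynomial.Derivative
import Mathlib.LinearAlgebra.Lagrange
import HarnessLib

/-!
# Writing an element of `ℚ(y)` as `λ⁻¹ v(y)` with `λ ∈ ℕ`, `v ∈ ℤ[Y]` of controlled height
# (the height half of the shape lemma in Bürgisser 2000, Thm. 4.5)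

Topic: `Literature/Computability/AlgebraicComplexity`. Bürgisser, *Cook's versus Valiant's
hypothesis*, TCS 235 (2000), Thm. 4.5 (p. 82): the solution is `x_i = λ⁻¹ v_i(y)` with "`λ` a
positive integer, `v_i ∈ ℤ[Y]`, `y` an algebraic number with primitive integer minimal polynomial
`g`", and `log λ, log wt(v_i) = d^{O(n)} log w`; there the heights come from Krick–Pardo's
arithmetic bounds for geometric resolutions. We PROVE the following self-contained statement,
which is what the elementary route of this library needs: let `g ∈ ℤ[Y]` be irreducible and
primitive of degree `e ≥ 1` with complex root `y`, let `r ∈ ℚ[Y]` have degree `< e`, and suppose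
`x = r(y)` is a root of a nonzero `Q ∈ ℤ[T]`. Then `x = λ⁻¹ v(y)` with `λ ∈ ℕ_{>0}`, `v ∈ ℤ[Y]`
of degree `< e`, and `λ, wt(v) ≤ (2 e H)^(3 e² + 3)` where `H = max(wt g, wt Q)`
(`exists_lam_v_of_root`).

Proof (Lagrange interpolation over the conjugates, made integral by a resultant). Let
`t_1, …, t_e` be the complex roots of `g` (distinct: `g` is separable), `a = lc(g)`, `b = lc(Q)`,
`R = Res(g, g') ∈ ℤ ∖ {0}`; then `R = a^{e-1} Π_i g'(t_i)` and `g'(t_i) = a Π_{j≠i}(t_i - t_j)`.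
Every `r(t_i)` is a root of `Q` (the minimal polynomial of `y` divides `Q ∘ r`). The polynomial
`W = a Σ_i c_i Π_{j≠i} (aY - a t_j)`, `c_i = b r(t_i) Π_{j≠i} a^{e-1} g'(t_j)`, has algebraic-integer
coefficients, degree `< e`, and `W(t_i) = Λ r(t_i)` with `Λ = b a^{(e-1)²} R ∈ ℤ`; hence
`W = Λ r`, so the coefficients of `Λ r` are rational algebraic integers, i.e. integers, and
`v = ± Λ r`, `λ = |Λ|`. The bounds follow from `|t_i| ≤ wt g`, `|r(t_i)| ≤ wt Q` (Cauchy) and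
`|R| ≤ (e · wt g)^{2e}` (Sylvester determinant).

## References

* P. Bürgisser, *Cook's versus Valiant's hypothesis*, TCS 235 (2000), Thm. 4.5 p. 82 (items
  "(2)", "(4)" of the printed proof) and Lemma 2.4. [Burgisser2000TCS]
-/

noncomputable section

open Polynomial

namespace Literature.Computability.AlgebraicComplexity

/-! ### The `ℓ¹` norm on `ℂ[Y]` -/

section CNorm

/-- `cnorm p = Σ_k ‖coeff_k p‖`, the `ℓ¹` norm of a complex polynomial. [folklore] -/
def cnorm (p : ℂ[X]) : ℝ := p.support.sum fun k => ‖p.coeff k‖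

/-- `cnorm` as a sum over any finite superset of the support. [folklore] -/
theorem cnorm_eq_sum_of_support_subset (p : ℂ[X]) {S : Finset ℕ} (hS : p.support ⊆ S) :
    cnorm p = ∑ k ∈ S, ‖p.coeff k‖ := by
  unfold cnorm
  refine Finset.sum_subset hS fun k _ hk => ?_
  rw [Polynomial.notMem_support_iff.1 hk, norm_zero]

/-- `0 ≤ cnorm p`. [folklore] -/
theorem cnorm_nonneg (p : ℂ[X]) : 0 ≤ cnorm p := Finset.sum_nonneg fun _ _ => norm_nonneg _

/-- `cnorm 0 = 0`. [folklore] -/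
@[simp] theorem cnorm_zero : cnorm 0 = 0 := by simp [cnorm]

/-- `‖coeff_k p‖ ≤ cnorm p`. [folklore] -/
theorem norm_coeff_le_cnorm (p : ℂ[X]) (k : ℕ) : ‖p.coeff k‖ ≤ cnorm p := by
  classical
  by_cases hk : k ∈ p.support
  · exact Finset.single_le_sum (f := fun k => ‖p.coeff k‖) (fun _ _ => norm_nonneg _) hk
  · rw [Polynomial.notMem_support_iff.1 hk, norm_zero]; exact cnorm_nonneg p

/-- `cnorm (monomial k c) = ‖c‖`. [folklore] -/
theorem cnorm_monomial (k : ℕ) (c : ℂ) : cnorm (monomial k c) = ‖c‖ := by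
  classical
  rcases eq_or_ne c 0 with rfl | hc
  · simp
  · rw [cnorm, support_monomial _ hc, Finset.sum_singleton, coeff_monomial, if_pos rfl]

/-- `cnorm (C c) = ‖c‖`. [folklore] -/
@[simp] theorem cnorm_C (c : ℂ) : cnorm (C c) = ‖c‖ := by rw [← monomial_zero_left, cnorm_monomial]

/-- `cnorm X = 1`. [folklore] -/
@[simp] theorem cnorm_X : cnorm (X : ℂ[X]) = 1 := by
  rw [← monomial_one_one_eq_X, cnorm_monomial, norm_one]

/-- Subadditivity. [folklore] -/
theorem cnorm_add_le (p q : ℂ[X]) : cnorm (p + q) ≤ cnorm p + cnorm q := by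
  classical
  rw [cnorm_eq_sum_of_support_subset (p + q) support_add,
    cnorm_eq_sum_of_support_subset p Finset.subset_union_left,
    cnorm_eq_sum_of_support_subset q Finset.subset_union_right, ← Finset.sum_add_distrib]
  exact Finset.sum_le_sum fun k _ => by rw [coeff_add]; exact norm_add_le _ _

/-- `cnorm (-p) = cnorm p`. [folklore] -/
@[simp] theorem cnorm_neg (p : ℂ[X]) : cnorm (-p) = cnorm p := by simp [cnorm]

/-- `cnorm (p - q) ≤ cnorm p + cnorm q`. [folklore] -/
theorem cnorm_sub_le (p q : ℂ[X]) : cnorm (p - q) ≤ cnorm p + cnorm q := by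
  rw [sub_eq_add_neg]; exact (cnorm_add_le _ _).trans (by rw [cnorm_neg])

/-- `cnorm (∑ pᵢ) ≤ ∑ cnorm pᵢ`. [folklore] -/
theorem cnorm_sum_le {ι : Type*} (s : Finset ι) (f : ι → ℂ[X]) :
    cnorm (∑ i ∈ s, f i) ≤ ∑ i ∈ s, cnorm (f i) := by
  classical
  induction s using Finset.cons_induction with
  | empty => simp
  | cons a s ha ih =>
    rw [Finset.sum_cons, Finset.sum_cons]
    exact (cnorm_add_le _ _).trans (add_le_add le_rfl ih)

/-- Submultiplicativity. [folklore] -/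
theorem cnorm_mul_le (p q : ℂ[X]) : cnorm (p * q) ≤ cnorm p * cnorm q := by
  classical
  rw [mul_eq_sum_sum]
  refine (cnorm_sum_le _ _).trans ?_
  calc ∑ i ∈ p.support, cnorm (q.sum fun j a => monomial (i + j) (p.coeff i * a))
      ≤ ∑ i ∈ p.support, ∑ j ∈ q.support, ‖p.coeff i‖ * ‖q.coeff j‖ := by
        refine Finset.sum_le_sum fun i _ => ?_
        rw [Polynomial.sum_def]
        refine (cnorm_sum_le _ _).trans (Finset.sum_le_sum fun j _ => ?_)
        rw [cnorm_monomial, norm_mul]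
    _ = cnorm p * cnorm q := by rw [cnorm, cnorm, Finset.sum_mul_sum]

/-- `cnorm (∏ pᵢ) ≤ ∏ cnorm pᵢ`. [folklore] -/
theorem cnorm_prod_le {ι : Type*} (s : Finset ι) (f : ι → ℂ[X]) :
    cnorm (∏ i ∈ s, f i) ≤ ∏ i ∈ s, cnorm (f i) := by
  classical
  induction s using Finset.cons_induction with
  | empty => rw [Finset.prod_empty, Finset.prod_empty, ← C_1, cnorm_C, norm_one]
  | cons a s ha ih =>
    rw [Finset.prod_cons, Finset.prod_cons]
    exact (cnorm_mul_le _ _).trans (mul_le_mul_of_nonneg_left ih (cnorm_nonneg _))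

/-- `cnorm (C a * X - C c) ≤ ‖a‖ + ‖c‖`. [folklore] -/
theorem cnorm_C_mul_X_sub_C_le (a c : ℂ) : cnorm (C a * X - C c) ≤ ‖a‖ + ‖c‖ := by
  refine (cnorm_sub_le _ _).trans ?_
  rw [cnorm_C]
  refine add_le_add ((cnorm_mul_le _ _).trans ?_) le_rfl
  rw [cnorm_C, cnorm_X, mul_one]

/-- Evaluation bound: `‖p(t)‖ ≤ cnorm p · max(1, ‖t‖)^{deg p}`. [folklore] -/
theorem norm_eval_le_cnorm_mul (p : ℂ[X]) (t : ℂ) :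
    ‖p.eval t‖ ≤ cnorm p * max 1 ‖t‖ ^ p.natDegree := by
  rw [eval_eq_sum_range, cnorm_eq_sum_of_support_subset p supp_subset_range_natDegree_succ,
    Finset.sum_mul]
  refine (norm_sum_le _ _).trans (Finset.sum_le_sum fun k hk => ?_)
  rw [norm_mul, norm_pow]
  refine mul_le_mul_of_nonneg_left ?_ (norm_nonneg _)
  calc ‖t‖ ^ k ≤ max 1 ‖t‖ ^ k := pow_le_pow_left₀ (norm_nonneg _) (le_max_right _ _) k
    _ ≤ max 1 ‖t‖ ^ p.natDegree :=
      pow_le_pow_right₀ (le_max_left _ _) (Nat.lt_succ_iff.1 (Finset.mem_range.1 hk))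

/-- The `ℓ¹` norm of an integer polynomial mapped to `ℂ` is its weight. [folklore] -/
theorem cnorm_map_eq_polyWeight (p : ℤ[X]) : cnorm (p.map (Int.castRingHom ℂ)) = polyWeight p := by
  classical
  rw [cnorm_eq_sum_of_support_subset _ (support_map_subset _ _), polyWeight, Nat.cast_sum]
  refine Finset.sum_congr rfl fun k _ => ?_
  rw [coeff_map, eq_intCast, Complex.norm_intCast, Nat.cast_natAbs, Int.cast_abs]

end CNorm

/-! ### Cauchy's bound and simple weight facts -/

section Cauchy

/-- **Cauchy's bound**: a complex root of a nonzero integer polynomial has absolute value at most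
the weight. [folklore] -/
theorem norm_root_le_polyWeight {p : ℤ[X]} (hp : p ≠ 0) {t : ℂ} (ht : aeval t p = 0) :
    ‖t‖ ≤ polyWeight p := by
  classical
  by_cases h1 : ‖t‖ ≤ 1
  · exact h1.trans (by exact_mod_cast one_le_polyWeight hp)
  push Not at h1
  -- `lc · t^m = -(lower terms)`
  set m := p.natDegree with hm
  have hm0 : 0 < m := by
    by_contra h0
    push Not at h0
    have hm0' : m = 0 := Nat.le_zero.1 h0
    obtain ⟨c, hc⟩ := natDegree_eq_zero.1 hm0'
    rw [← hc, aeval_C, eq_intCast, Int.cast_eq_zero] at ht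
    rw [← hc, ht, C_0] at hp
    exact hp rfl
  have hsum : (p.leadingCoeff : ℂ) * t ^ m = -∑ k ∈ Finset.range m, (p.coeff k : ℂ) * t ^ k := by
    rw [aeval_def, eval₂_eq_sum_range, Finset.sum_range_succ] at ht
    simp only [eq_intCast] at ht
    rw [eq_neg_iff_add_eq_zero, add_comm]
    exact ht
  have hlc : 1 ≤ ‖(p.leadingCoeff : ℂ)‖ := by
    rw [Complex.norm_intCast]
    have : (1 : ℤ) ≤ |p.leadingCoeff| := Int.one_le_abs (leadingCoeff_ne_zero.2 hp)
    exact_mod_cast this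
  have hbound : ‖t‖ ^ m ≤ (∑ k ∈ Finset.range m, ((p.coeff k).natAbs : ℝ)) * ‖t‖ ^ (m - 1) := by
    have h := congrArg (fun z : ℂ => ‖z‖) hsum
    simp only [norm_mul, norm_neg, norm_pow] at h
    calc ‖t‖ ^ m ≤ ‖(p.leadingCoeff : ℂ)‖ * ‖t‖ ^ m :=
          le_mul_of_one_le_left (pow_nonneg (norm_nonneg _) _) hlc
      _ = ‖∑ k ∈ Finset.range m, (p.coeff k : ℂ) * t ^ k‖ := h
      _ ≤ ∑ k ∈ Finset.range m, ‖(p.coeff k : ℂ) * t ^ k‖ := norm_sum_le _ _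
      _ ≤ ∑ k ∈ Finset.range m, ((p.coeff k).natAbs : ℝ) * ‖t‖ ^ (m - 1) := by
          refine Finset.sum_le_sum fun k hk => ?_
          rw [norm_mul, norm_pow, Complex.norm_intCast, Nat.cast_natAbs, Int.cast_abs]
          refine mul_le_mul_of_nonneg_left ?_ (abs_nonneg _)
          exact pow_le_pow_right₀ h1.le (by have := Finset.mem_range.1 hk; omega)
      _ = (∑ k ∈ Finset.range m, ((p.coeff k).natAbs : ℝ)) * ‖t‖ ^ (m - 1) := by
          rw [Finset.sum_mul]
  have hpos : 0 < ‖t‖ ^ (m - 1) := pow_pos (by linarith) _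
  have hle : ‖t‖ ≤ ∑ k ∈ Finset.range m, ((p.coeff k).natAbs : ℝ) := by
    have : ‖t‖ ^ m = ‖t‖ * ‖t‖ ^ (m - 1) := by
      rw [← pow_succ', Nat.sub_add_cancel hm0]
    rw [this] at hbound
    exact le_of_mul_le_mul_right hbound hpos
  refine hle.trans ?_
  rw [polyWeight_eq_sum_range p (Nat.lt_succ_self _), Nat.cast_sum, Finset.sum_range_succ]
  exact le_add_of_nonneg_right (Nat.cast_nonneg _)

/-- `wt(g') ≤ deg g · wt(g)`. [folklore] -/
theorem polyWeight_derivative_le (g : ℤ[X]) : polyWeight (derivative g) ≤ g.natDegree * polyWeight g := by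
  by_cases hN : g.natDegree = 0
  · obtain ⟨c, hc⟩ := natDegree_eq_zero.1 hN
    rw [← hc, derivative_C, polyWeight_zero]
    exact Nat.zero_le _
  have hdeg : (derivative g).natDegree < g.natDegree := natDegree_derivative_lt hN
  rw [polyWeight_eq_sum_range _ hdeg, polyWeight_eq_sum_range g (Nat.lt_succ_self _),
    Finset.sum_range_succ']
  calc ∑ k ∈ Finset.range g.natDegree, ((derivative g).coeff k).natAbs
      ≤ ∑ k ∈ Finset.range g.natDegree, g.natDegree * (g.coeff (k + 1)).natAbs := by
        refine Finset.sum_le_sum fun k hk => ?_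
        rw [coeff_derivative, Int.natAbs_mul, mul_comm]
        refine Nat.mul_le_mul_right _ ?_
        have h1 : ((k : ℤ) + 1).natAbs = k + 1 := by
          rw [show ((k : ℤ) + 1) = ((k + 1 : ℕ) : ℤ) by push_cast; ring, Int.natAbs_natCast]
        rw [h1]
        exact Finset.mem_range.1 hk
    _ = g.natDegree * ∑ k ∈ Finset.range g.natDegree, (g.coeff (k + 1)).natAbs := by
        rw [Finset.mul_sum]
    _ ≤ g.natDegree * (∑ k ∈ Finset.range g.natDegree, (g.coeff (k + 1)).natAbs +
          (g.coeff 0).natAbs) := Nat.mul_le_mul_left _ (Nat.le_add_right _ _)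

end Cauchy

/-! ### Polynomials with algebraic-integer coefficients -/

section IntCoeffs

/-- `IntCoeffs p`: every coefficient of `p ∈ ℂ[Y]` is integral over `ℤ`. [folklore] -/
def IntCoeffs (p : ℂ[X]) : Prop := ∀ k, IsIntegral ℤ (p.coeff k)

/-- `0` has integral coefficients. [folklore] -/
theorem intCoeffs_zero : IntCoeffs 0 := fun k => by rw [coeff_zero]; exact isIntegral_zero

/-- Sums. [folklore] -/
theorem IntCoeffs.add {p q : ℂ[X]} (hp : IntCoeffs p) (hq : IntCoeffs q) : IntCoeffs (p + q) :=
  fun k => by rw [coeff_add]; exact (hp k).add (hq k)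

/-- Products. [folklore] -/
theorem IntCoeffs.mul {p q : ℂ[X]} (hp : IntCoeffs p) (hq : IntCoeffs q) : IntCoeffs (p * q) :=
  fun k => by
    rw [coeff_mul]
    exact IsIntegral.sum _ fun x _ => (hp _).mul (hq _)

/-- Finite sums. [folklore] -/
theorem IntCoeffs.sum {ι : Type*} (s : Finset ι) {f : ι → ℂ[X]} (h : ∀ i ∈ s, IntCoeffs (f i)) :
    IntCoeffs (∑ i ∈ s, f i) := by
  classical
  induction s using Finset.induction_on with
  | empty => rw [Finset.sum_empty]; exact intCoeffs_zero
  | insert a s ha ih =>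
    rw [Finset.sum_insert ha]
    exact (h a (Finset.mem_insert_self a s)).add (ih fun i hi => h i (Finset.mem_insert_of_mem hi))

/-- Constants. [folklore] -/
theorem intCoeffs_C {c : ℂ} (hc : IsIntegral ℤ c) : IntCoeffs (C c) := fun k => by
  rw [coeff_C]; split_ifs
  · exact hc
  · exact isIntegral_zero

/-- `1` has integral coefficients. [folklore] -/
theorem intCoeffs_one : IntCoeffs 1 := by rw [← C_1]; exact intCoeffs_C isIntegral_one

/-- Finite products. [folklore] -/
theorem IntCoeffs.prod {ι : Type*} (s : Finset ι) {f : ι → ℂ[X]} (h : ∀ i ∈ s, IntCoeffs (f i)) :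
    IntCoeffs (∏ i ∈ s, f i) := by
  classical
  induction s using Finset.induction_on with
  | empty => rw [Finset.prod_empty]; exact intCoeffs_one
  | insert a s ha ih =>
    rw [Finset.prod_insert ha]
    exact (h a (Finset.mem_insert_self a s)).mul (ih fun i hi => h i (Finset.mem_insert_of_mem hi))

/-- `X` has integral coefficients. [folklore] -/
theorem intCoeffs_X : IntCoeffs (X : ℂ[X]) := fun k => by
  rw [coeff_X]; split_ifs
  · exact isIntegral_one
  · exact isIntegral_zero

/-- `C a * X - C c` has integral coefficients if `a, c` are integral. [folklore] -/
theorem intCoeffs_C_mul_X_sub_C {a c : ℂ} (ha : IsIntegral ℤ a) (hc : IsIntegral ℤ c) :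
    IntCoeffs (C a * X - C c) := by
  rw [sub_eq_add_neg, ← C_neg]
  exact ((intCoeffs_C ha).mul intCoeffs_X).add (intCoeffs_C hc.neg)

/-- Integers are integral. [folklore] -/
theorem isIntegral_intCast (m : ℤ) : IsIntegral ℤ (m : ℂ) := by
  have : (m : ℂ) = algebraMap ℤ ℂ m := by simp
  rw [this]; exact isIntegral_algebraMap

end IntCoeffs

/-! ### The size of a resultant -/

section ResultantBound

/-- Partial sums of `|coeff|` are bounded by the weight. [folklore] -/
theorem sum_natAbs_coeff_le_polyWeight (g : ℤ[X]) (T : Finset ℕ) :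
    ∑ k ∈ T, (g.coeff k).natAbs ≤ polyWeight g := by
  classical
  rw [polyWeight_eq_sum_of_support_subset g (Finset.subset_union_left (s₂ := T))]
  exact Finset.sum_le_sum_of_subset_of_nonneg Finset.subset_union_right fun _ _ _ => Nat.zero_le _

/-- A column of shifted coefficients has absolute sum `≤ wt`. [folklore] -/
theorem sum_natAbs_shift_le {N : ℕ} (g : ℤ[X]) (j w : ℕ) :
    ∑ i : Fin N, (if (i : ℕ) ∈ Set.Icc j (j + w) then g.coeff (i - j) else 0).natAbs ≤ polyWeight g := by
  classical
  have h1 : ∑ i : Fin N, (if (i : ℕ) ∈ Set.Icc j (j + w) then g.coeff (i - j) else 0).natAbs =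
      ∑ i ∈ (Finset.univ : Finset (Fin N)).filter (fun i : Fin N => (i : ℕ) ∈ Set.Icc j (j + w)),
        (g.coeff (i - j)).natAbs := by
    rw [Finset.sum_filter]
    refine Finset.sum_congr rfl fun i _ => ?_
    split_ifs <;> simp
  rw [h1]
  set F := (Finset.univ : Finset (Fin N)).filter (fun i : Fin N => (i : ℕ) ∈ Set.Icc j (j + w)) with hF
  have hinj : Set.InjOn (fun i : Fin N => (i : ℕ) - j) F := by
    intro i hi i' hi' h
    have hi1 := (Finset.mem_filter.1 hi).2.1
    have hi'1 := (Finset.mem_filter.1 hi').2.1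
    apply Fin.ext
    dsimp only at h
    omega
  calc ∑ i ∈ F, (g.coeff (i - j)).natAbs
      = ∑ k ∈ F.image (fun i : Fin N => (i : ℕ) - j), (g.coeff k).natAbs := by
        rw [Finset.sum_image hinj]
    _ ≤ polyWeight g := sum_natAbs_coeff_le_polyWeight g _

/-- `|det M| ≤ Π_i Σ_j |M j i|` for an integer matrix. [folklore] -/
theorem natAbs_det_le_prod_sum {ι : Type*} [Fintype ι] [DecidableEq ι] (M : Matrix ι ι ℤ) :
    M.det.natAbs ≤ ∏ i, ∑ j, (M j i).natAbs := by
  rw [Matrix.det_apply]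
  refine (Int.natAbs_sum_le _ _).trans ?_
  calc ∑ σ : Equiv.Perm ι, (Equiv.Perm.sign σ • ∏ i, M (σ i) i).natAbs
      = ∑ σ : Equiv.Perm ι, ∏ i, (M (σ i) i).natAbs := by
        refine Finset.sum_congr rfl fun σ _ => ?_
        rw [Units.smul_def, smul_eq_mul, Int.natAbs_mul, Int.units_natAbs, one_mul]
        exact map_prod Int.natAbsHom _ _
    _ ≤ ∏ i, ∑ j, (M j i).natAbs := sum_perm_prod_le_prod_sum fun j i => (M j i).natAbs

/-- **Size of a resultant**: `|Res_{m,n}(f, g)| ≤ wt(g)^m · wt(f)^n`. [folklore] -/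
theorem natAbs_resultant_le (f g : ℤ[X]) (m n : ℕ) :
    (resultant f g m n).natAbs ≤ polyWeight g ^ m * polyWeight f ^ n := by
  classical
  unfold resultant
  refine (natAbs_det_le_prod_sum _).trans ?_
  rw [Fin.prod_univ_add]
  refine Nat.mul_le_mul ?_ ?_
  · calc ∏ i : Fin m, ∑ j : Fin (m + n), (sylvester f g m n j (Fin.castAdd n i)).natAbs
        ≤ ∏ _i : Fin m, polyWeight g := Finset.prod_le_prod' fun i _ => by
          simp only [sylvester, Matrix.of_apply, Fin.addCases_left]
          exact sum_natAbs_shift_le g i n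
      _ = polyWeight g ^ m := by rw [Finset.prod_const, Finset.card_univ, Fintype.card_fin]
  · calc ∏ i : Fin n, ∑ j : Fin (m + n), (sylvester f g m n j (Fin.natAdd m i)).natAbs
        ≤ ∏ _i : Fin n, polyWeight f := Finset.prod_le_prod' fun i _ => by
          simp only [sylvester, Matrix.of_apply, Fin.addCases_right]
          exact sum_natAbs_shift_le f i m
      _ = polyWeight f ^ n := by rw [Finset.prod_const, Finset.card_univ, Fintype.card_fin]

end ResultantBound

/-! ### The representation `x = λ⁻¹ v(y)` -/

section Main

/-- Powers of a number `≥ 1` are monotone in the exponent (helper). [folklore] -/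
theorem pow_le_pow_of_le_one_le {M : ℝ} (hM : 1 ≤ M) {i j : ℕ} (hij : i ≤ j) : M ^ i ≤ M ^ j :=
  pow_le_pow_right₀ hM hij

set_option maxHeartbeats 1600000 in
/-- **Writing `x ∈ ℚ(y)` as `λ⁻¹ v(y)` with height control** (the height half of the shape lemma;
Bürgisser 2000, Thm. 4.5: "`x_i = λ⁻¹ v_i(y)` … `log λ, log wt(v_i) = d^{O(n)} log w`"). Let
`g ∈ ℤ[Y]` be irreducible and primitive of degree `e ≥ 1` with complex root `y`, `r ∈ ℚ[Y]` of
degree `< e`, and let `x = r(y)` be a root of `0 ≠ Q ∈ ℤ[T]`. If `wt g, wt Q ≤ H` then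
`x = λ⁻¹ v(y)` for some `λ ∈ ℕ_{>0}` and `v ∈ ℤ[Y]` of degree `< e` with
`λ, wt(v) ≤ (2 e H)^{3 e² + 3}`. See the module docstring for the proof (Lagrange interpolation
over the conjugates of `y`, made integral with `Res(g, g')`). [cite: Burgisser2000TCS, Thm. 4.5 p. 82] -/
theorem exists_lam_v_of_root {g Q : ℤ[X]} (hg : Irreducible g) (hgprim : g.IsPrimitive)
    (he : 0 < g.natDegree) {y : ℂ} (hy : aeval y g = 0) (r : ℚ[X]) (hr : r.natDegree < g.natDegree)
    (hQ : Q ≠ 0) (hx : aeval (aeval y (r.map (algebraMap ℚ ℂ))) Q = 0) {H : ℕ}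
    (hHg : polyWeight g ≤ H) (hHQ : polyWeight Q ≤ H) :
    ∃ (lam : ℕ) (v : ℤ[X]), 0 < lam ∧ v.natDegree < g.natDegree ∧
      aeval y (r.map (algebraMap ℚ ℂ)) = (lam : ℂ)⁻¹ * aeval y v ∧
      lam ≤ (2 * g.natDegree * H) ^ (3 * g.natDegree ^ 2 + 3) ∧
      polyWeight v ≤ (2 * g.natDegree * H) ^ (3 * g.natDegree ^ 2 + 3) := by
  classical
  -- notation
  set e := g.natDegree with he_def
  set a : ℤ := g.leadingCoeff with ha_def
  set b : ℤ := Q.leadingCoeff with hb_def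
  set gC : ℂ[X] := g.map (Int.castRingHom ℂ) with hgC
  set rC : ℂ[X] := r.map (algebraMap ℚ ℂ) with hrC
  have hg0 : g ≠ 0 := hg.ne_zero
  have ha0 : a ≠ 0 := leadingCoeff_ne_zero.2 hg0
  have hb0 : b ≠ 0 := leadingCoeff_ne_zero.2 hQ
  have haC0 : (a : ℂ) ≠ 0 := Int.cast_ne_zero.2 ha0
  have hgCdeg : gC.natDegree = e := natDegree_map_eq_of_injective Int.cast_injective g
  have hgClc : gC.leadingCoeff = a := by
    rw [hgC, leadingCoeff_map_of_injective Int.cast_injective, eq_intCast]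
  have hgC0 : gC ≠ 0 := fun h => ha0 (by
    have := hgClc; rw [h, leadingCoeff_zero] at this; exact_mod_cast this.symm)
  have haeval : ∀ t : ℂ, aeval t g = gC.eval t := fun t => by
    rw [hgC, eval_map, aeval_def, algebraMap_int_eq]
  -- over `ℚ`: irreducible, separable, minimal polynomial
  set gQ : ℚ[X] := g.map (Int.castRingHom ℚ) with hgQ
  have hgQirr : Irreducible gQ := (hgprim.irreducible_iff_irreducible_map_fraction_map (K := ℚ)).1 hg
  have hgQC : gQ.map (algebraMap ℚ ℂ) = gC := by
    rw [hgQ, hgC, map_map]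
    congr 1
  have haevalQ : ∀ t : ℂ, aeval t gQ = aeval t g := fun t => by
    rw [hgQ, ← algebraMap_int_eq, aeval_map_algebraMap]
  have hsep : gC.Separable := by rw [← hgQC]; exact hgQirr.separable.map
  have hnodup : gC.roots.Nodup := nodup_roots hsep
  -- the roots
  set S : Finset ℂ := gC.roots.toFinset with hS
  have hSval : S.val = gC.roots := by rw [hS, Multiset.toFinset_val, hnodup.dedup]
  have hsplit : gC.Splits := IsAlgClosed.splits gC
  have hcardroots : Multiset.card gC.roots = e := by
    rw [← hgCdeg]; exact (splits_iff_card_roots.1 hsplit)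
  have hScard : S.card = e := by rw [hS, Multiset.toFinset_card_of_nodup hnodup, hcardroots]
  have hmemS : ∀ t, t ∈ S ↔ aeval t g = 0 := fun t => by
    rw [hS, Multiset.mem_toFinset, mem_roots hgC0, IsRoot.def, haeval]
  have hyS : y ∈ S := (hmemS y).2 hy
  have he1 : 1 ≤ e := he
  have hScard' : ∀ t ∈ S, (S.erase t).card = e - 1 := fun t ht => by
    rw [Finset.card_erase_of_mem ht, hScard]
  -- `gC = a · Π (X - t)`
  have hprod : C (a : ℂ) * ∏ t ∈ S, (X - C t) = gC := by
    have h := C_leadingCoeff_mul_prod_multiset_X_sub_C (p := gC) (by rw [hcardroots, hgCdeg])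
    rw [hgClc] at h
    rw [← h, Finset.prod_eq_multiset_prod, hSval]
  -- derivative at a root
  have hder : ∀ t ∈ S, (derivative gC).eval t = (a : ℂ) * ∏ τ ∈ S.erase t, (t - τ) := by
    intro t ht
    rw [← hprod, derivative_C_mul, eval_mul, eval_C, Finset.prod_eq_multiset_prod,
      eval_multiset_prod_X_sub_C_derivative (by exact ht), ← Finset.erase_val,
      ← Finset.prod_eq_multiset_prod]
  have hder0 : ∀ t ∈ S, (derivative gC).eval t ≠ 0 := by
    intro t ht
    rw [hder t ht]
    refine mul_ne_zero haC0 (Finset.prod_ne_zero_iff.2 fun τ hτ => sub_ne_zero.2 ?_)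
    exact fun h => (Finset.mem_erase.1 hτ).1 h.symm
  -- the resultant
  set R : ℤ := resultant g (derivative g) e (e - 1) with hR_def
  have hRC : (R : ℂ) = (a : ℂ) ^ (e - 1) * ∏ t ∈ S, (derivative gC).eval t := by
    have h1 : (R : ℂ) = resultant gC (derivative gC) e (e - 1) := by
      rw [hR_def, hgC, derivative_map, resultant_map_map, eq_intCast]
    have h2 := resultant_eq_prod_eval gC (derivative gC) (e - 1)
      ((natDegree_derivative_le gC).trans (by rw [hgCdeg])) hsplit
    rw [hgCdeg, hgClc] at h2
    rw [h1, h2, Finset.prod_eq_multiset_prod, hSval]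
  have hR0 : R ≠ 0 := by
    intro h0
    have : (R : ℂ) = 0 := by rw [h0, Int.cast_zero]
    rw [hRC] at this
    exact (mul_ne_zero (pow_ne_zero _ haC0) (Finset.prod_ne_zero_iff.2 hder0)) this
  -- conjugates of `x` are roots of `Q`
  have hrCeval : ∀ t : ℂ, rC.eval t = aeval t r := fun t => by rw [hrC, eval_map, aeval_def]
  have hQroot : ∀ t ∈ S, aeval (rC.eval t) Q = 0 := by
    intro t ht
    have hgQy : aeval y gQ = 0 := by rw [haevalQ]; exact hy
    have hyint : IsIntegral ℚ y := (show IsAlgebraic ℚ y from ⟨gQ, hgQirr.ne_zero, hgQy⟩).isIntegral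
    have hmin : minpoly ℚ y ∣ gQ := minpoly.dvd ℚ y hgQy
    have hdvd' : gQ ∣ minpoly ℚ y := (minpoly.irreducible hyint).dvd_symm hgQirr hmin
    have hmint : aeval t (minpoly ℚ y) = 0 := by
      obtain ⟨c, hc⟩ := hdvd'
      rw [hc, map_mul, haevalQ, (hmemS t).1 ht, zero_mul]
    set QQ : ℚ[X] := Q.map (Int.castRingHom ℚ) with hQQ
    have haevalQQ : ∀ z : ℂ, aeval z QQ = aeval z Q := fun z => by
      rw [hQQ, ← algebraMap_int_eq, aeval_map_algebraMap]
    have hcomp : aeval y (QQ.comp r) = 0 := by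
      rw [aeval_comp, haevalQQ]
      have : aeval y r = aeval y rC := by rw [hrC, aeval_map_algebraMap]
      rw [this]; exact hx
    obtain ⟨c, hc⟩ := minpoly.dvd ℚ y hcomp
    have h := congrArg (aeval t) hc
    rw [map_mul, hmint, zero_mul, aeval_comp, haevalQQ] at h
    rw [hrCeval]; exact h
  -- integral elements
  have hInt_at : ∀ t ∈ S, IsIntegral ℤ ((a : ℂ) * t) := by
    intro t ht
    have h := isIntegral_leadingCoeff_smul (R := ℤ) (S := ℂ) (p := g) (x := t) ((hmemS t).1 ht)
    rwa [← ha_def, zsmul_eq_mul] at h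
  have hInt_bx : ∀ t ∈ S, IsIntegral ℤ ((b : ℂ) * rC.eval t) := by
    intro t ht
    have h := isIntegral_leadingCoeff_smul (R := ℤ) (S := ℂ) (p := Q) (x := rC.eval t) (hQroot t ht)
    rwa [← hb_def, zsmul_eq_mul] at h
  have hgCder_deg : (derivative gC).natDegree ≤ e - 1 :=
    (natDegree_derivative_le gC).trans (by rw [hgCdeg])
  have hInt_gder : ∀ t ∈ S, IsIntegral ℤ ((a : ℂ) ^ (e - 1) * (derivative gC).eval t) := by
    intro t ht
    rw [eval_eq_sum_range' (lt_of_le_of_lt hgCder_deg (Nat.sub_lt he1 Nat.one_pos) : _ < e),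
      Finset.mul_sum]
    refine IsIntegral.sum _ fun k hk => ?_
    have hk' : k ≤ e - 1 := by have := Finset.mem_range.1 hk; omega
    have : (a : ℂ) ^ (e - 1) * ((derivative gC).coeff k * t ^ k) =
        (derivative gC).coeff k * (((a : ℂ) * t) ^ k * (a : ℂ) ^ (e - 1 - k)) := by
      have hsplit : (a : ℂ) ^ (e - 1) = (a : ℂ) ^ k * (a : ℂ) ^ (e - 1 - k) := by
        rw [← pow_add, Nat.add_sub_cancel' hk']
      rw [hsplit, mul_pow]
      ring
    rw [this]
    refine IsIntegral.mul ?_ (((hInt_at t ht).pow _).mul ((isIntegral_intCast a).pow _))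
    rw [hgC, derivative_map, coeff_map, eq_intCast]
    exact isIntegral_intCast _
  -- the polynomial `W`
  set cf : ℂ → ℂ := fun t => ((b : ℂ) * rC.eval t) *
    ∏ τ ∈ S.erase t, ((a : ℂ) ^ (e - 1) * (derivative gC).eval τ) with hcf
  set Wp : ℂ[X] := C (a : ℂ) * ∑ t ∈ S, C (cf t) * ∏ τ ∈ S.erase t, (C (a : ℂ) * X - C ((a : ℂ) * τ))
    with hWp
  have hWint : IntCoeffs Wp := by
    rw [hWp]
    refine (intCoeffs_C (isIntegral_intCast a)).mul (IntCoeffs.sum _ fun t ht => ?_)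
    refine (intCoeffs_C ?_).mul (IntCoeffs.prod _ fun τ hτ => ?_)
    · rw [hcf]
      exact (hInt_bx t ht).mul (IsIntegral.prod _ fun τ hτ => hInt_gder τ (Finset.mem_of_mem_erase hτ))
    · exact intCoeffs_C_mul_X_sub_C (isIntegral_intCast a) (hInt_at τ (Finset.mem_of_mem_erase hτ))
  -- `Λ` and the evaluation identity
  set Λ : ℤ := b * a ^ ((e - 1) ^ 2) * R with hΛ
  have hΛ0 : Λ ≠ 0 := mul_ne_zero (mul_ne_zero hb0 (pow_ne_zero _ ha0)) hR0
  have heval : ∀ t ∈ S, Wp.eval t = (Λ : ℂ) * rC.eval t := by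
    intro t ht
    have hzero : ∀ t' ∈ S, t' ≠ t →
        (C (cf t') * ∏ τ ∈ S.erase t', (C (a : ℂ) * X - C ((a : ℂ) * τ))).eval t = 0 := by
      intro t' ht' hne
      rw [eval_mul, eval_prod]
      refine mul_eq_zero_of_right _ (Finset.prod_eq_zero (Finset.mem_erase.2 ⟨hne.symm, ht⟩) ?_)
      rw [eval_sub, eval_mul, eval_C, eval_X, eval_C, sub_self]
    rw [hWp, eval_mul, eval_C, eval_finsetSum, Finset.sum_eq_single t (fun t' ht' hne => hzero t' ht' hne)
      (fun h => absurd ht h), eval_mul, eval_C, eval_prod]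
    have hlin : ∏ τ ∈ S.erase t, (C (a : ℂ) * X - C ((a : ℂ) * τ)).eval t =
        (a : ℂ) ^ (e - 1) * ∏ τ ∈ S.erase t, (t - τ) := by
      rw [← hScard' t ht, ← Finset.prod_const, ← Finset.prod_mul_distrib]
      refine Finset.prod_congr rfl fun τ _ => ?_
      rw [eval_sub, eval_mul, eval_C, eval_X, eval_C]; ring
    rw [hlin]
    -- now `a * (cf t * (a^(e-1) * Π (t - τ))) = Λ * x_t`
    have hkey : cf t * ((a : ℂ) ^ (e - 1) * (derivative gC).eval t) =
        (b : ℂ) * rC.eval t * ((a : ℂ) ^ ((e - 1) * e) * ∏ τ ∈ S, (derivative gC).eval τ) := by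
      rw [hcf]
      dsimp only
      rw [mul_assoc, Finset.prod_erase_mul _ _ ht, Finset.prod_mul_distrib, Finset.prod_const, hScard,
        ← pow_mul]
    calc (a : ℂ) * (cf t * ((a : ℂ) ^ (e - 1) * ∏ τ ∈ S.erase t, (t - τ)))
        = cf t * ((a : ℂ) ^ (e - 1) * ((a : ℂ) * ∏ τ ∈ S.erase t, (t - τ))) := by ring
      _ = cf t * ((a : ℂ) ^ (e - 1) * (derivative gC).eval t) := by rw [hder t ht]
      _ = (b : ℂ) * rC.eval t * ((a : ℂ) ^ ((e - 1) * e) * ∏ τ ∈ S, (derivative gC).eval τ) := hkey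
      _ = (b : ℂ) * rC.eval t * ((a : ℂ) ^ ((e - 1) ^ 2) * ((a : ℂ) ^ (e - 1) *
            ∏ τ ∈ S, (derivative gC).eval τ)) := by
          have : (e - 1) * e = (e - 1) ^ 2 + (e - 1) := by
            rw [sq, ← Nat.mul_succ, Nat.succ_eq_add_one, Nat.sub_add_cancel he1]
          rw [this, pow_add]; ring
      _ = (Λ : ℂ) * rC.eval t := by rw [← hRC, hΛ]; push_cast; ring
  -- `Wp = Λ · rC`
  have hrdeg : rC.natDegree < e := lt_of_le_of_lt natDegree_map_le hr
  have hWdeg : Wp.degree < e := by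
    refine lt_of_le_of_lt (degree_le_natDegree) ?_
    have hnat : Wp.natDegree ≤ e - 1 := by
      rw [hWp]
      refine (natDegree_C_mul_le _ _).trans (natDegree_sum_le_of_forall_le _ _ fun t ht => ?_)
      refine (natDegree_C_mul_le _ _).trans ((natDegree_prod_le _ _).trans ?_)
      rw [← hScard' t ht]
      calc ∑ τ ∈ S.erase t, (C (a : ℂ) * X - C ((a : ℂ) * τ)).natDegree ≤ ∑ _τ ∈ S.erase t, 1 :=
            Finset.sum_le_sum (f := fun τ => (C (a : ℂ) * X - C ((a : ℂ) * τ)).natDegree)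
              (g := fun _ => 1) fun τ _ => (natDegree_sub_le _ _).trans (max_le
              ((natDegree_C_mul_le _ _).trans natDegree_X_le) (by rw [natDegree_C]; exact zero_le_one))
        _ = (S.erase t).card := by rw [Finset.sum_const, smul_eq_mul, mul_one]
    exact_mod_cast lt_of_le_of_lt hnat (Nat.sub_lt he1 Nat.one_pos)
  have hΛC0 : (Λ : ℂ) ≠ 0 := Int.cast_ne_zero.2 hΛ0
  have hΛrdeg : (C (Λ : ℂ) * rC).degree < e := by
    rw [degree_C_mul hΛC0]
    exact lt_of_le_of_lt degree_le_natDegree (by exact_mod_cast hrdeg)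
  have hWeq : Wp = C (Λ : ℂ) * rC := by
    refine eq_of_degrees_lt_of_eval_finset_eq (s := S) (by rw [hScard]; exact hWdeg)
      (by rw [hScard]; exact hΛrdeg) fun t ht => ?_
    rw [heval t ht, eval_mul, eval_C]
  -- the coefficients of `Λ r` are integers
  have hcoeff : ∀ k, ∃ m : ℤ, (m : ℚ) = (Λ : ℚ) * r.coeff k := by
    intro k
    have hint : IsIntegral ℤ ((Λ : ℂ) * algebraMap ℚ ℂ (r.coeff k)) := by
      have := hWint k
      rwa [hWeq, coeff_C_mul, hrC, coeff_map] at this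
    have hint' : IsIntegral ℤ (algebraMap ℚ ℂ ((Λ : ℚ) * r.coeff k)) := by
      rwa [map_mul, map_intCast]
    rw [isIntegral_algebraMap_iff (algebraMap ℚ ℂ).injective] at hint'
    obtain ⟨m, hm⟩ := (IsIntegrallyClosed.isIntegral_iff (R := ℤ) (K := ℚ)).1 hint'
    exact ⟨m, by rw [← hm]; rfl⟩
  choose m hm using hcoeff
  set v₀ : ℤ[X] := ∑ k ∈ Finset.range e, C (m k) * X ^ k with hv₀
  have hrcoeff0 : ∀ k, e ≤ k → r.coeff k = 0 := fun k hk =>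
    coeff_eq_zero_of_natDegree_lt (lt_of_lt_of_le hr hk)
  have hv₀coeff : ∀ k, (v₀.coeff k : ℚ) = (Λ : ℚ) * r.coeff k := by
    intro k
    rw [hv₀, finsetSum_coeff]
    simp only [coeff_C_mul_X_pow]
    by_cases hk : k < e
    · rw [Finset.sum_eq_single k (fun k' _ hne => if_neg (Ne.symm hne))
        (fun h => absurd (Finset.mem_range.2 hk) h), if_pos rfl, hm]
    · rw [Finset.sum_eq_zero fun k' hk' => if_neg (fun h : k = k' =>
          hk (lt_of_eq_of_lt h (Finset.mem_range.1 hk'))),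
        Int.cast_zero, hrcoeff0 k (not_lt.1 hk), mul_zero]
  have hv₀C : v₀.map (Int.castRingHom ℂ) = C (Λ : ℂ) * rC := by
    ext k
    rw [coeff_map, eq_intCast, coeff_C_mul, hrC, coeff_map, eq_ratCast,
      ← Rat.cast_intCast (v₀.coeff k), hv₀coeff k]
    push_cast
    ring
  have hv₀deg : v₀.natDegree < e := by
    have : v₀.natDegree ≤ e - 1 := by
      rw [hv₀]
      refine natDegree_sum_le_of_forall_le _ _ fun k hk => (natDegree_C_mul_X_pow_le _ _).trans ?_
      have := Finset.mem_range.1 hk; omega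
    omega
  have haevalv₀ : aeval y v₀ = (Λ : ℂ) * aeval y rC := by
    rw [← aeval_map_algebraMap ℂ, algebraMap_int_eq, hv₀C, map_mul, aeval_C]
    rfl
  -- `λ` and `v`
  refine ⟨Λ.natAbs, C (Int.sign Λ) * v₀, Int.natAbs_pos.2 hΛ0,
    lt_of_le_of_lt (natDegree_C_mul_le _ _) hv₀deg, ?_, ?_, ?_⟩
  · -- the identity `x = λ⁻¹ v(y)`
    have hsl : ((Λ.sign : ℤ) : ℂ) * (Λ : ℂ) = (Λ.natAbs : ℂ) := by
      rw [← Int.cast_mul, Int.sign_mul_self_eq_natAbs, Int.cast_natCast]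
    have hne : (Λ.natAbs : ℂ) ≠ 0 := by exact_mod_cast (Int.natAbs_pos.2 hΛ0).ne'
    rw [map_mul, aeval_C, algebraMap_int_eq, eq_intCast, haevalv₀, ← mul_assoc ((Λ.sign : ℤ) : ℂ),
      hsl, ← mul_assoc, inv_mul_cancel₀ hne, one_mul]
  · -- the bound for `λ`
    have hH1 : 1 ≤ H := (one_le_polyWeight hg0).trans hHg
    have habs : Λ.natAbs ≤ H * H ^ ((e - 1) ^ 2) * ((e * H) ^ e * H ^ (e - 1)) := by
      rw [hΛ, Int.natAbs_mul, Int.natAbs_mul, Int.natAbs_pow]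
      refine Nat.mul_le_mul (Nat.mul_le_mul ?_ (Nat.pow_le_pow_left ?_ _)) ?_
      · exact le_trans (by rw [hb_def]; exact natAbs_coeff_le_polyWeight Q _) hHQ
      · exact le_trans (by rw [ha_def]; exact natAbs_coeff_le_polyWeight g _) hHg
      · refine (natAbs_resultant_le _ _ _ _).trans (Nat.mul_le_mul (Nat.pow_le_pow_left ?_ _)
          (Nat.pow_le_pow_left hHg _))
        exact (polyWeight_derivative_le g).trans (Nat.mul_le_mul_left _ hHg)
    refine habs.trans ?_
    have hHN : H ≤ 2 * e * H := Nat.le_mul_of_pos_left H (by omega)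
    have heHN : e * H ≤ 2 * e * H := Nat.mul_le_mul_right H (by omega)
    have hM1 : 1 ≤ 2 * e * H := hH1.trans hHN
    calc H * H ^ ((e - 1) ^ 2) * ((e * H) ^ e * H ^ (e - 1))
        ≤ (2 * e * H) * (2 * e * H) ^ ((e - 1) ^ 2) * ((2 * e * H) ^ e * (2 * e * H) ^ (e - 1)) :=
          Nat.mul_le_mul (Nat.mul_le_mul hHN (Nat.pow_le_pow_left hHN _))
            (Nat.mul_le_mul (Nat.pow_le_pow_left heHN _) (Nat.pow_le_pow_left hHN _))
      _ = (2 * e * H) ^ (1 + (e - 1) ^ 2 + (e + (e - 1))) := by ring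
      _ ≤ (2 * e * H) ^ (3 * e ^ 2 + 3) := Nat.pow_le_pow_right hM1 (by
          have h1 : (e - 1) ^ 2 ≤ e ^ 2 := Nat.pow_le_pow_left (Nat.sub_le _ _) _
          have h2 : e - 1 ≤ e := Nat.sub_le _ _
          have h3 : e ≤ e ^ 2 := by nlinarith
          linarith)
  · -- the bound for `wt(v)`
    have hH1 : 1 ≤ H := (one_le_polyWeight hg0).trans hHg
    have hwv : polyWeight (C (Int.sign Λ) * v₀) = polyWeight v₀ := by
      rw [polyWeight_C_mul, Int.natAbs_sign_of_ne_zero hΛ0, one_mul]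
    rw [hwv]
    -- pass to `ℝ` through `cnorm`
    have hreal : (polyWeight v₀ : ℝ) = cnorm Wp := by rw [← cnorm_map_eq_polyWeight, hv₀C, hWeq]
    set Mr : ℝ := ((2 * e * H : ℕ) : ℝ) with hMr
    have hHr1 : (1 : ℝ) ≤ H := by exact_mod_cast hH1
    have her1 : (1 : ℝ) ≤ e := by exact_mod_cast he1
    have hHM : (H : ℝ) ≤ Mr := by rw [hMr]; push_cast; nlinarith
    have heM : (e : ℝ) ≤ Mr := by rw [hMr]; push_cast; nlinarith
    have hM1 : (1 : ℝ) ≤ Mr := hHr1.trans hHM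
    have hM0 : (0 : ℝ) ≤ Mr := zero_le_one.trans hM1
    have hHH : (H : ℝ) + H * H ≤ Mr ^ 2 := by
      have h1 : (H : ℝ) ≤ H * H := le_mul_of_one_le_left (by positivity) hHr1
      have h2 : (1 : ℝ) ≤ e * e := one_le_mul_of_one_le_of_one_le her1 her1
      have h3 : (2 * (e : ℝ) * H) ^ 2 = 4 * (e * e) * (H * H) := by ring
      rw [hMr]; push_cast; rw [h3]
      nlinarith [mul_nonneg (sub_nonneg.2 h2) (mul_self_nonneg (H : ℝ)), mul_self_nonneg (H : ℝ)]
    -- elementary bounds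
    have hnorm_int : ∀ z : ℤ, ‖(z : ℂ)‖ = ((z.natAbs : ℕ) : ℝ) := fun z => by
      rw [Complex.norm_intCast, Nat.cast_natAbs, Int.cast_abs]
    have hna : ‖(a : ℂ)‖ ≤ H := by
      rw [hnorm_int]
      exact_mod_cast le_trans (by rw [ha_def]; exact natAbs_coeff_le_polyWeight g _) hHg
    have hnb : ‖(b : ℂ)‖ ≤ H := by
      rw [hnorm_int]
      exact_mod_cast le_trans (by rw [hb_def]; exact natAbs_coeff_le_polyWeight Q _) hHQ
    have hnt : ∀ t ∈ S, ‖t‖ ≤ H := fun t ht =>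
      (norm_root_le_polyWeight hg0 ((hmemS t).1 ht)).trans (by exact_mod_cast hHg)
    have hnx : ∀ t ∈ S, ‖rC.eval t‖ ≤ H := fun t ht =>
      (norm_root_le_polyWeight hQ (hQroot t ht)).trans (by exact_mod_cast hHQ)
    have hcnder : cnorm (derivative gC) ≤ e * H := by
      rw [hgC, derivative_map, cnorm_map_eq_polyWeight]
      exact_mod_cast (polyWeight_derivative_le g).trans (Nat.mul_le_mul_left _ hHg)
    have hnder : ∀ t ∈ S, ‖(derivative gC).eval t‖ ≤ e * H * H ^ (e - 1) := by
      intro t ht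
      refine (norm_eval_le_cnorm_mul _ _).trans (mul_le_mul hcnder ?_ (pow_nonneg
        (zero_le_one.trans (le_max_left _ _)) _) (by positivity))
      calc max 1 ‖t‖ ^ (derivative gC).natDegree ≤ (H : ℝ) ^ (derivative gC).natDegree :=
            pow_le_pow_left₀ (zero_le_one.trans (le_max_left _ _)) (max_le hHr1 (hnt t ht)) _
        _ ≤ (H : ℝ) ^ (e - 1) := pow_le_pow_right₀ hHr1 hgCder_deg
    have hnader : ∀ t ∈ S, ‖(a : ℂ) ^ (e - 1) * (derivative gC).eval t‖ ≤ Mr ^ (2 * e) := by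
      intro t ht
      rw [norm_mul, norm_pow]
      calc ‖(a : ℂ)‖ ^ (e - 1) * ‖(derivative gC).eval t‖
          ≤ Mr ^ (e - 1) * (Mr * Mr * Mr ^ (e - 1)) := by
            refine mul_le_mul (pow_le_pow_left₀ (norm_nonneg _) (hna.trans hHM) _)
              ((hnder t ht).trans ?_) (norm_nonneg _) (pow_nonneg hM0 _)
            exact mul_le_mul (mul_le_mul heM hHM (by positivity) hM0)
              (pow_le_pow_left₀ (by positivity) hHM _) (by positivity) (by positivity)
        _ = Mr ^ (e - 1 + (1 + 1 + (e - 1))) := by ring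
        _ = Mr ^ (2 * e) := by congr 1; omega
    have hncf : ∀ t ∈ S, ‖cf t‖ ≤ Mr ^ 2 * (Mr ^ (2 * e)) ^ (e - 1) := by
      intro t ht
      have hpc : (Mr ^ (2 * e)) ^ (e - 1) = ∏ _τ ∈ S.erase t, Mr ^ (2 * e) := by
        rw [Finset.prod_const, hScard' t ht]
      have hp : ‖∏ τ ∈ S.erase t, ((a : ℂ) ^ (e - 1) * (derivative gC).eval τ)‖ ≤
          (Mr ^ (2 * e)) ^ (e - 1) := by
        rw [norm_prod, hpc]
        exact Finset.prod_le_prod (fun _ _ => norm_nonneg _) fun τ hτ =>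
          hnader τ (Finset.mem_of_mem_erase hτ)
      have hbx : ‖(b : ℂ) * rC.eval t‖ ≤ Mr ^ 2 := by
        rw [norm_mul, sq]
        exact mul_le_mul (hnb.trans hHM) ((hnx t ht).trans hHM) (norm_nonneg _) hM0
      rw [hcf]
      dsimp only
      rw [norm_mul]
      exact mul_le_mul hbx hp (norm_nonneg _) (by positivity)
    have hnlin : ∀ t ∈ S, cnorm (∏ τ ∈ S.erase t, (C (a : ℂ) * X - C ((a : ℂ) * τ))) ≤
        (Mr ^ 2) ^ (e - 1) := by
      intro t ht
      refine (cnorm_prod_le _ _).trans ?_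
      rw [← hScard' t ht, ← Finset.prod_const]
      refine Finset.prod_le_prod (fun _ _ => cnorm_nonneg _) fun τ hτ => ?_
      refine (cnorm_C_mul_X_sub_C_le _ _).trans ?_
      rw [norm_mul]
      calc ‖(a : ℂ)‖ + ‖(a : ℂ)‖ * ‖τ‖ ≤ H + H * H :=
            add_le_add hna (mul_le_mul hna (hnt τ (Finset.mem_of_mem_erase hτ)) (norm_nonneg _)
              (by positivity))
        _ ≤ Mr ^ 2 := hHH
    have hterm : ∀ t ∈ S, cnorm (C (cf t) * ∏ τ ∈ S.erase t, (C (a : ℂ) * X - C ((a : ℂ) * τ))) ≤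
        Mr ^ 2 * (Mr ^ (2 * e)) ^ (e - 1) * (Mr ^ 2) ^ (e - 1) := fun t ht => by
      refine (cnorm_mul_le _ _).trans ?_
      rw [cnorm_C]
      exact mul_le_mul (hncf t ht) (hnlin t ht) (cnorm_nonneg _) (by positivity)
    have hsum : cnorm (∑ t ∈ S, C (cf t) * ∏ τ ∈ S.erase t, (C (a : ℂ) * X - C ((a : ℂ) * τ))) ≤
        e * (Mr ^ 2 * (Mr ^ (2 * e)) ^ (e - 1) * (Mr ^ 2) ^ (e - 1)) := by
      refine (cnorm_sum_le _ _).trans ((Finset.sum_le_sum hterm).trans ?_)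
      rw [Finset.sum_const, hScard, nsmul_eq_mul]
    have hexp : 4 + 2 * e * (e - 1) + 2 * (e - 1) = 2 * e ^ 2 + 2 := by
      obtain ⟨f, hf⟩ := Nat.exists_eq_add_of_le he1
      rw [hf, Nat.add_sub_cancel_left]
      ring
    have hcW : cnorm Wp ≤ Mr ^ (2 * e ^ 2 + 2) := by
      rw [hWp]
      refine (cnorm_mul_le _ _).trans ?_
      rw [cnorm_C]
      refine (mul_le_mul hna hsum (cnorm_nonneg _) (by positivity)).trans ?_
      calc (H : ℝ) * (e * (Mr ^ 2 * (Mr ^ (2 * e)) ^ (e - 1) * (Mr ^ 2) ^ (e - 1)))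
          ≤ Mr * (Mr * (Mr ^ 2 * (Mr ^ (2 * e)) ^ (e - 1) * (Mr ^ 2) ^ (e - 1))) := by gcongr
        _ = Mr ^ (4 + 2 * e * (e - 1) + 2 * (e - 1)) := by rw [← pow_mul, ← pow_mul]; ring
        _ = Mr ^ (2 * e ^ 2 + 2) := by rw [hexp]
    have hfin : (polyWeight v₀ : ℝ) ≤ Mr ^ (3 * e ^ 2 + 3) := by
      rw [hreal]
      exact hcW.trans (pow_le_pow_right₀ hM1 (by nlinarith))
    rw [hMr] at hfin
    exact_mod_cast hfin

end Main

end Literature.Computability.AlgebraicComplexity
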